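import Literature.NumberTheory.ConnesMoscovici2022.UVProlateDeficiencyWeak
import Literature.NumberTheory.ConnesMoscovici2022.UVProlateDeficiencyEndpoints
import Mathlib.Analysis.Calculus.BumpFunction.FiniteDimension
import HarnessLib

/-!
# Connes–Moscovici 2022, Lemma 1.1 — part C: the count.  `dim Ker(W_max − z) = 4` for every
# `z ∈ ℂ`; the deficiency indices of `W_min` are `(4, 4)` (`CM22_lemma_1_1_holds`)

LINE 1 — FRAMING. RH-FREE corpus literature (spectral theory of the prolate wave operator
`W_λ = −∂(λ² − x²)∂ + (2πλx)²` on `L²(ℝ)`; sequel row of the Connes–Consani corpus, no leaf / binder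
role).  bears_on: LADDER-RH W-C/W-P.  WHAT THIS IS NOT: any claim about RH; nothing in this file
mentions `RiemannHypothesis` or bears on the truth of RH.

This file DISCHARGES the named fact `Literature.NumberTheory.ConnesMoscovici2022.CM22_lemma_1_1`
(**Lemma 1.1** of A. Connes, H. Moscovici, *The UV prolate spectrum matches the zeros of zeta*, PNAS
119 (2022) [bib: `ConnesMoscovici2022`] = arXiv:2112.05500 Lemma 2.1, chunk p0004:L39–L48: "The
deficiency indices of `W_min` are `(4,4)`"), following the printed proof (quoted in full in the header
of `UVProlateDeficiencyODE.lean`) with the inputs of parts A (`UVProlateDeficiencyODE`: classical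
solutions on the three components), B (`UVProlateDeficiencyWeak`: eigenvectors are piecewise
classical; Green's identity with the two jump terms; distributional solutions are eigenvectors) and
the a-priori endpoint package `UVProlateDeficiencyEndpoints` (rh-crit-cc-t10: all four singular
points are limit circle — one-sided limits of `p g′`, square integrability, decay at `±∞`, and a
solution with non-zero boundary value of `p g′` on each outer component):

* §2 "uniquely specified by six parameters": the chosen solution pairs on the three components with
  data at `−λ − 1`, `0`, `λ + 1`, their linearity in the data (uniqueness), and the glued function
  `G d`, `d ∈ ℂ⁶` (an `indicator` sum, so `G d (±λ) = 0` and `d ↦ G d` is linear on the nose);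
* §3 the a-priori package of `G d` and the two MATCHING FUNCTIONALS
  `jumpMap d = (jump of p (G d)′ at λ, jump at −λ) ∈ ℂ²` ("the logarithmic singularities of `ξ` on
  the left and the right of `±λ` have to match. This reduces the number of parameters to `4`");
* §4 `T d = [G d] ∈ L²(ℝ)` as a linear map, injective; `T (ker jumpMap) = Ker(W_max − z)`
  (⊆: Green's identity, "any solution … belongs to `Dom(W_max)`"; ⊇: part B's classical
  representatives); `jumpMap` is onto `ℂ²` (t10's `exists_sol_Ioi/Iio_tendsto_ne_zero`), so
  rank–nullity gives `finrank (Ker(W_max − z)) = 6 − 2 = 4` for EVERY `z ∈ ℂ`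
  (`finrank_eigenspace_prolateMax`), in particular for `z = ±i`: `CM22_lemma_1_1_holds`.

Private `def`s (the chosen solutions, `G`, the boundary values, `jumpMap`, `T`) are proof plumbing;
no new named fact, no `sorry`.  Nothing in this file bears on the truth of RH.
-/

noncomputable section

open Complex Set MeasureTheory Filter SchwartzMap
open scoped Real Topology ContDiff

namespace Literature.NumberTheory.ConnesMoscovici2022

open Literature.NumberTheory.ConnesConsani2021 Literature.NumberTheory.ConnesConsani2024

/-! ## §1 Reflection of solution pairs -/

/-- The equation is even: if `(g, g′)` is a solution pair on `(−∞, −λ)` then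
`(x ↦ g(−x), x ↦ −g′(−x))` is a solution pair on `(λ, ∞)`. [cite: ConnesMoscovici2022, §1 ¶1 "invariant under the parity exchange" (= arXiv §2 ¶1, chunk p0004:L14)] -/
theorem sol_reflect_Iio {lam : ℝ} {z : ℂ} {g g' : ℝ → ℂ}
    (hg : ∀ x ∈ Iio (-lam), HasDerivAt g (g' x) x)
    (hu : ∀ x ∈ Iio (-lam), HasDerivAt (fun y ↦ pCoeff lam y * g' y) ((qCoeff lam x - z) * g x) x) :
    (∀ x ∈ Ioi lam, HasDerivAt (fun y ↦ g (-y)) (-g' (-x)) x) ∧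
      ∀ x ∈ Ioi lam, HasDerivAt (fun y ↦ pCoeff lam y * -g' (-y)) ((qCoeff lam x - z) * g (-x)) x := by
  have hpe : ∀ x, pCoeff lam (-x) = pCoeff lam x := fun x ↦ by simp [pCoeff]
  have hqe : ∀ x, qCoeff lam (-x) = qCoeff lam x := fun x ↦ by simp [qCoeff]
  have key : ∀ x ∈ Ioi lam, HasDerivAt (fun y ↦ g (-y)) (-g' (-x)) x ∧
      HasDerivAt (fun y ↦ pCoeff lam y * -g' (-y)) ((qCoeff lam x - z) * g (-x)) x := by
    intro x hx
    have hx' : -x ∈ Iio (-lam) := by simp only [mem_Iio]; linarith [mem_Ioi.1 hx]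
    have hn : HasDerivAt (fun y : ℝ ↦ -y) (-1 : ℝ) x := hasDerivAt_neg x
    constructor
    · have := (hg (-x) hx').scomp x hn
      simpa [Function.comp_def] using this
    · have h2' := (hu (-x) hx').scomp x hn
      have : (fun y ↦ pCoeff lam y * -g' (-y)) =
          fun y ↦ -((fun y ↦ pCoeff lam y * g' y) ∘ fun y ↦ -y) y := by
        funext y; simp [hpe]
      rw [this]
      refine (h2'.neg).congr_deriv ?_
      simp [hqe]
  exact ⟨fun x hx ↦ (key x hx).1, fun x hx ↦ (key x hx).2⟩

/-! ## §2 The chosen solution pairs on the three components, truncated to their component -/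

section Chosen

variable {lam : ℝ} (hlam : 0 < lam) (z : ℂ)

/-- `λ < λ + 1`. [folklore] -/
private theorem lt_add_one' : lam < lam + 1 := by linarith
/-- `−λ − 1 < −λ`. [folklore] -/
private theorem neg_sub_one_lt : -lam - 1 < -lam := by linarith

include hlam in
/-- `0 ∈ (−λ, λ)`. [folklore] -/
private theorem zero_mem_Ioo : (0 : ℝ) ∈ Ioo (-lam) lam := ⟨by linarith, hlam⟩

/-- The chosen solution on `(λ, ∞)` with data `(a, b)` at `λ + 1` (part A, `exists_sol_Ioi`). [folklore] -/
private def solR (a b : ℂ) : ℝ → ℂ :=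
  Classical.choose (exists_sol_Ioi hlam z (lt_add_one' (lam := lam)) a b)

/-- Its derivative. [folklore] -/
private def solR' (a b : ℂ) : ℝ → ℂ :=
  Classical.choose (Classical.choose_spec (exists_sol_Ioi hlam z (lt_add_one' (lam := lam)) a b))

/-- Specification of the right chosen solution. [folklore] -/
private theorem solR_spec (a b : ℂ) :
    solR hlam z a b (lam + 1) = a ∧ pCoeff lam (lam + 1) * solR' hlam z a b (lam + 1) = b ∧
      ∀ x ∈ Ioi lam, HasDerivAt (solR hlam z a b) (solR' hlam z a b x) x ∧
        HasDerivAt (fun y ↦ pCoeff lam y * solR' hlam z a b y)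
          ((qCoeff lam x - z) * solR hlam z a b x) x :=
  Classical.choose_spec (Classical.choose_spec (exists_sol_Ioi hlam z (lt_add_one' (lam := lam)) a b))

/-- The chosen solution on `(−∞, −λ)` with data `(a, b)` at `−λ − 1`. [folklore] -/
private def solL (a b : ℂ) : ℝ → ℂ :=
  Classical.choose (exists_sol_Iio hlam z (neg_sub_one_lt (lam := lam)) a b)

/-- Its derivative. [folklore] -/
private def solL' (a b : ℂ) : ℝ → ℂ :=
  Classical.choose (Classical.choose_spec (exists_sol_Iio hlam z (neg_sub_one_lt (lam := lam)) a b))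

/-- Specification of the left chosen solution. [folklore] -/
private theorem solL_spec (a b : ℂ) :
    solL hlam z a b (-lam - 1) = a ∧ pCoeff lam (-lam - 1) * solL' hlam z a b (-lam - 1) = b ∧
      ∀ x ∈ Iio (-lam), HasDerivAt (solL hlam z a b) (solL' hlam z a b x) x ∧
        HasDerivAt (fun y ↦ pCoeff lam y * solL' hlam z a b y)
          ((qCoeff lam x - z) * solL hlam z a b x) x :=
  Classical.choose_spec (Classical.choose_spec (exists_sol_Iio hlam z (neg_sub_one_lt (lam := lam)) a b))

/-- The chosen solution on `(−λ, λ)` with data `(a, b)` at `0`. [folklore] -/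
private def solM (a b : ℂ) : ℝ → ℂ :=
  Classical.choose (exists_sol_Ioo z (zero_mem_Ioo hlam) a b)

/-- Its derivative. [folklore] -/
private def solM' (a b : ℂ) : ℝ → ℂ :=
  Classical.choose (Classical.choose_spec (exists_sol_Ioo z (zero_mem_Ioo hlam) a b))

/-- Specification of the middle chosen solution. [folklore] -/
private theorem solM_spec (a b : ℂ) :
    solM hlam z a b 0 = a ∧ pCoeff lam 0 * solM' hlam z a b 0 = b ∧
      ∀ x ∈ Ioo (-lam) lam, HasDerivAt (solM hlam z a b) (solM' hlam z a b x) x ∧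
        HasDerivAt (fun y ↦ pCoeff lam y * solM' hlam z a b y)
          ((qCoeff lam x - z) * solM hlam z a b x) x :=
  Classical.choose_spec (Classical.choose_spec (exists_sol_Ioo z (zero_mem_Ioo hlam) a b))

/-! ### Linearity of the chosen solutions in the data (uniqueness) -/

include hlam in
/-- Linearity of the right chosen solution in its data (uniqueness, part A). [folklore] -/
private theorem solR_lin (c₁ c₂ a₁ b₁ a₂ b₂ : ℂ) :
    EqOn (solR hlam z (c₁ * a₁ + c₂ * a₂) (c₁ * b₁ + c₂ * b₂))
        (fun x ↦ c₁ * solR hlam z a₁ b₁ x + c₂ * solR hlam z a₂ b₂ x) (Ioi lam) ∧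
      EqOn (solR' hlam z (c₁ * a₁ + c₂ * a₂) (c₁ * b₁ + c₂ * b₂))
        (fun x ↦ c₁ * solR' hlam z a₁ b₁ x + c₂ * solR' hlam z a₂ b₂ x) (Ioi lam) := by
  obtain ⟨h0, h1, hs⟩ := solR_spec hlam z (c₁ * a₁ + c₂ * a₂) (c₁ * b₁ + c₂ * b₂)
  obtain ⟨h0₁, h1₁, hs₁⟩ := solR_spec hlam z a₁ b₁
  obtain ⟨h0₂, h1₂, hs₂⟩ := solR_spec hlam z a₂ b₂
  obtain ⟨hc, hcu⟩ := sol_linear_comb c₁ c₂ (fun x hx ↦ (hs₁ x hx).1) (fun x hx ↦ (hs₁ x hx).2)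
    (fun x hx ↦ (hs₂ x hx).1) (fun x hx ↦ (hs₂ x hx).2)
  refine eqOn_of_sol_Ioi hlam (lt_add_one' (lam := lam)) (fun x hx ↦ (hs x hx).1)
    (fun x hx ↦ (hs x hx).2) hc hcu ?_ ?_
  · simp only [h0, h0₁, h0₂]
  · rw [h1, mul_add, ← mul_assoc, mul_comm (pCoeff lam (lam + 1)) c₁, mul_assoc, h1₁, ← mul_assoc,
      mul_comm (pCoeff lam (lam + 1)) c₂, mul_assoc, h1₂]

include hlam in
/-- Linearity of the left chosen solution in its data (uniqueness, part A). [folklore] -/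
private theorem solL_lin (c₁ c₂ a₁ b₁ a₂ b₂ : ℂ) :
    EqOn (solL hlam z (c₁ * a₁ + c₂ * a₂) (c₁ * b₁ + c₂ * b₂))
        (fun x ↦ c₁ * solL hlam z a₁ b₁ x + c₂ * solL hlam z a₂ b₂ x) (Iio (-lam)) ∧
      EqOn (solL' hlam z (c₁ * a₁ + c₂ * a₂) (c₁ * b₁ + c₂ * b₂))
        (fun x ↦ c₁ * solL' hlam z a₁ b₁ x + c₂ * solL' hlam z a₂ b₂ x) (Iio (-lam)) := by
  obtain ⟨h0, h1, hs⟩ := solL_spec hlam z (c₁ * a₁ + c₂ * a₂) (c₁ * b₁ + c₂ * b₂)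
  obtain ⟨h0₁, h1₁, hs₁⟩ := solL_spec hlam z a₁ b₁
  obtain ⟨h0₂, h1₂, hs₂⟩ := solL_spec hlam z a₂ b₂
  obtain ⟨hc, hcu⟩ := sol_linear_comb c₁ c₂ (fun x hx ↦ (hs₁ x hx).1) (fun x hx ↦ (hs₁ x hx).2)
    (fun x hx ↦ (hs₂ x hx).1) (fun x hx ↦ (hs₂ x hx).2)
  refine eqOn_of_sol_Iio hlam (neg_sub_one_lt (lam := lam)) (fun x hx ↦ (hs x hx).1)
    (fun x hx ↦ (hs x hx).2) hc hcu ?_ ?_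
  · simp only [h0, h0₁, h0₂]
  · rw [h1, mul_add, ← mul_assoc, mul_comm (pCoeff lam (-lam - 1)) c₁, mul_assoc, h1₁, ← mul_assoc,
      mul_comm (pCoeff lam (-lam - 1)) c₂, mul_assoc, h1₂]

include hlam in
/-- Linearity of the middle chosen solution in its data (uniqueness, part A). [folklore] -/
private theorem solM_lin (c₁ c₂ a₁ b₁ a₂ b₂ : ℂ) :
    EqOn (solM hlam z (c₁ * a₁ + c₂ * a₂) (c₁ * b₁ + c₂ * b₂))
        (fun x ↦ c₁ * solM hlam z a₁ b₁ x + c₂ * solM hlam z a₂ b₂ x) (Ioo (-lam) lam) ∧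
      EqOn (solM' hlam z (c₁ * a₁ + c₂ * a₂) (c₁ * b₁ + c₂ * b₂))
        (fun x ↦ c₁ * solM' hlam z a₁ b₁ x + c₂ * solM' hlam z a₂ b₂ x) (Ioo (-lam) lam) := by
  obtain ⟨h0, h1, hs⟩ := solM_spec hlam z (c₁ * a₁ + c₂ * a₂) (c₁ * b₁ + c₂ * b₂)
  obtain ⟨h0₁, h1₁, hs₁⟩ := solM_spec hlam z a₁ b₁
  obtain ⟨h0₂, h1₂, hs₂⟩ := solM_spec hlam z a₂ b₂
  obtain ⟨hc, hcu⟩ := sol_linear_comb c₁ c₂ (fun x hx ↦ (hs₁ x hx).1) (fun x hx ↦ (hs₁ x hx).2)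
    (fun x hx ↦ (hs₂ x hx).1) (fun x hx ↦ (hs₂ x hx).2)
  refine eqOn_of_sol_Ioo (Ioo_subset_setOf_ne_ne lam) (zero_mem_Ioo hlam) (fun x hx ↦ (hs x hx).1)
    (fun x hx ↦ (hs x hx).2) hc hcu ?_ ?_
  · simp only [h0, h0₁, h0₂]
  · rw [h1, mul_add, ← mul_assoc, mul_comm (pCoeff lam 0) c₁, mul_assoc, h1₁, ← mul_assoc,
      mul_comm (pCoeff lam 0) c₂, mul_assoc, h1₂]

/-! ### The glued function `G d` and its derivative `G′ d` -/

/-- The glued piecewise solution with data `d ∈ ℂ⁶`: `(d 0, d 1)` at `−λ−1` on `(−∞, −λ)`,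
`(d 2, d 3)` at `0` on `(−λ, λ)`, `(d 4, d 5)` at `λ + 1` on `(λ, ∞)`; value `0` at `±λ`.
[cite: ConnesMoscovici2022, Lemma 1.1 proof "uniquely specified by six parameters" (= arXiv Lemma 2.1, chunk p0004:L41–L44)] -/
private def glue (d : Fin 6 → ℂ) : ℝ → ℂ :=
  (Iio (-lam)).indicator (solL hlam z (d 0) (d 1)) + (Ioo (-lam) lam).indicator (solM hlam z (d 2) (d 3)) +
    (Ioi lam).indicator (solR hlam z (d 4) (d 5))

/-- The glued derivative. [folklore] -/
private def glue' (d : Fin 6 → ℂ) : ℝ → ℂ :=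
  (Iio (-lam)).indicator (solL' hlam z (d 0) (d 1)) + (Ioo (-lam) lam).indicator (solM' hlam z (d 2) (d 3)) +
    (Ioi lam).indicator (solR' hlam z (d 4) (d 5))

include hlam in
/-- On `(λ, ∞)`, `G d` is the right chosen solution. [folklore] -/
private theorem glue_eqOn_R (d : Fin 6 → ℂ) : EqOn (glue hlam z d) (solR hlam z (d 4) (d 5)) (Ioi lam) ∧
    EqOn (glue' hlam z d) (solR' hlam z (d 4) (d 5)) (Ioi lam) := by
  constructor <;> intro x hx
  all_goals
    have h1 : x ∉ Iio (-lam) := by simp only [mem_Iio, not_lt]; linarith [mem_Ioi.1 hx]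
    have h2 : x ∉ Ioo (-lam) lam := fun h ↦ (lt_irrefl _ (h.2.trans hx))
    simp [glue, glue', indicator_of_notMem h1, indicator_of_notMem h2, indicator_of_mem hx]

include hlam in
/-- On `(−∞, −λ)`, `G d` is the left chosen solution. [folklore] -/
private theorem glue_eqOn_L (d : Fin 6 → ℂ) : EqOn (glue hlam z d) (solL hlam z (d 0) (d 1)) (Iio (-lam)) ∧
    EqOn (glue' hlam z d) (solL' hlam z (d 0) (d 1)) (Iio (-lam)) := by
  constructor <;> intro x hx
  all_goals
    have h1 : x ∉ Ioi lam := by simp only [mem_Ioi, not_lt]; linarith [mem_Iio.1 hx]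
    have h2 : x ∉ Ioo (-lam) lam := fun h ↦ (lt_irrefl _ (hx.trans h.1))
    simp [glue, glue', indicator_of_notMem h1, indicator_of_notMem h2, indicator_of_mem hx]

include hlam in
/-- On `(−λ, λ)`, `G d` is the middle chosen solution. [folklore] -/
private theorem glue_eqOn_M (d : Fin 6 → ℂ) :
    EqOn (glue hlam z d) (solM hlam z (d 2) (d 3)) (Ioo (-lam) lam) ∧
    EqOn (glue' hlam z d) (solM' hlam z (d 2) (d 3)) (Ioo (-lam) lam) := by
  constructor <;> intro x hx
  all_goals
    have h1 : x ∉ Ioi lam := by simp only [mem_Ioi, not_lt]; exact hx.2.le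
    have h2 : x ∉ Iio (-lam) := by simp only [mem_Iio, not_lt]; exact hx.1.le
    simp [glue, glue', indicator_of_notMem h1, indicator_of_notMem h2, indicator_of_mem hx]

include hlam in
/-- `G d (±λ) = 0`. [folklore] -/
private theorem glue_apply_lam (d : Fin 6 → ℂ) : glue hlam z d lam = 0 ∧ glue hlam z d (-lam) = 0 := by
  have h1 : lam ∉ Iio (-lam) := by simp; linarith
  have h2 : -lam ∉ Ioi lam := by simp; linarith
  simp [glue, h1, h2]

/-- `G` is linear in the data (everywhere on `ℝ`). [folklore] -/
private theorem glue_lin (c₁ c₂ : ℂ) (d₁ d₂ : Fin 6 → ℂ) :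
    glue hlam z (c₁ • d₁ + c₂ • d₂) = c₁ • glue hlam z d₁ + c₂ • glue hlam z d₂ ∧
      glue' hlam z (c₁ • d₁ + c₂ • d₂) = c₁ • glue' hlam z d₁ + c₂ • glue' hlam z d₂ := by
  have eL := solL_lin hlam z c₁ c₂ (d₁ 0) (d₁ 1) (d₂ 0) (d₂ 1)
  have eM := solM_lin hlam z c₁ c₂ (d₁ 2) (d₁ 3) (d₂ 2) (d₂ 3)
  have eR := solR_lin hlam z c₁ c₂ (d₁ 4) (d₁ 5) (d₂ 4) (d₂ 5)
  constructor
  all_goals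
    funext x
    simp only [glue, glue', Pi.add_apply, Pi.smul_apply, smul_eq_mul]
    by_cases hL : x ∈ Iio (-lam)
    · have h1 : x ∉ Ioi lam := by simp only [mem_Ioi, not_lt]; linarith [mem_Iio.1 hL]
      have h2 : x ∉ Ioo (-lam) lam := fun h ↦ (lt_irrefl _ (hL.trans h.1))
      simp only [indicator_of_mem hL, indicator_of_notMem h1, indicator_of_notMem h2, add_zero]
      first | rw [eL.1 hL] | rw [eL.2 hL]
    by_cases hM : x ∈ Ioo (-lam) lam
    · have h1 : x ∉ Ioi lam := by simp only [mem_Ioi, not_lt]; exact hM.2.le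
      simp only [indicator_of_mem hM, indicator_of_notMem h1, indicator_of_notMem hL, add_zero, zero_add]
      first | rw [eM.1 hM] | rw [eM.2 hM]
    by_cases hR : x ∈ Ioi lam
    · simp only [indicator_of_mem hR, indicator_of_notMem hM, indicator_of_notMem hL, zero_add]
      first | rw [eR.1 hR] | rw [eR.2 hR]
    · simp only [indicator_of_notMem hR, indicator_of_notMem hM, indicator_of_notMem hL, add_zero]
      ring

/-- `G` is a classical solution pair off `±λ`. [cite: ConnesMoscovici2022, Lemma 1.1 proof (= arXiv Lemma 2.1, chunk p0004:L41–L44)] -/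
private theorem glue_sol (d : Fin 6 → ℂ) :
    (∀ x ∈ {x : ℝ | x ≠ lam ∧ x ≠ -lam}, HasDerivAt (glue hlam z d) (glue' hlam z d x) x) ∧
    ∀ x ∈ {x : ℝ | x ≠ lam ∧ x ≠ -lam},
      HasDerivAt (fun y ↦ pCoeff lam y * glue' hlam z d y) ((qCoeff lam x - z) * glue hlam z d x) x := by
  have key : ∀ x ∈ {x : ℝ | x ≠ lam ∧ x ≠ -lam}, HasDerivAt (glue hlam z d) (glue' hlam z d x) x ∧
      HasDerivAt (fun y ↦ pCoeff lam y * glue' hlam z d y) ((qCoeff lam x - z) * glue hlam z d x) x := by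
    intro x hx
    rcases lt_trichotomy x (-lam) with hL | hL | hL
    · -- on `(−∞, −λ)`
      have hxL : x ∈ Iio (-lam) := hL
      obtain ⟨-, -, hs⟩ := solL_spec hlam z (d 0) (d 1)
      have hev : ∀ᶠ y in 𝓝 x, y ∈ Iio (-lam) := isOpen_Iio.mem_nhds hxL
      have e1 : glue hlam z d =ᶠ[𝓝 x] solL hlam z (d 0) (d 1) := by
        filter_upwards [hev] with y hy using (glue_eqOn_L hlam z d).1 hy
      have e2 : (fun y ↦ pCoeff lam y * glue' hlam z d y) =ᶠ[𝓝 x]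
          fun y ↦ pCoeff lam y * solL' hlam z (d 0) (d 1) y := by
        filter_upwards [hev] with y hy using by rw [(glue_eqOn_L hlam z d).2 hy]
      refine ⟨?_, ?_⟩
      · rw [(glue_eqOn_L hlam z d).2 hxL]; exact (hs x hxL).1.congr_of_eventuallyEq e1
      · rw [(glue_eqOn_L hlam z d).1 hxL]; exact (hs x hxL).2.congr_of_eventuallyEq e2
    · exact absurd hL hx.2
    rcases lt_trichotomy x lam with hR | hR | hR
    · have hxM : x ∈ Ioo (-lam) lam := ⟨hL, hR⟩
      obtain ⟨-, -, hs⟩ := solM_spec hlam z (d 2) (d 3)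
      have hev : ∀ᶠ y in 𝓝 x, y ∈ Ioo (-lam) lam := isOpen_Ioo.mem_nhds hxM
      have e1 : glue hlam z d =ᶠ[𝓝 x] solM hlam z (d 2) (d 3) := by
        filter_upwards [hev] with y hy using (glue_eqOn_M hlam z d).1 hy
      have e2 : (fun y ↦ pCoeff lam y * glue' hlam z d y) =ᶠ[𝓝 x]
          fun y ↦ pCoeff lam y * solM' hlam z (d 2) (d 3) y := by
        filter_upwards [hev] with y hy using by rw [(glue_eqOn_M hlam z d).2 hy]
      refine ⟨?_, ?_⟩
      · rw [(glue_eqOn_M hlam z d).2 hxM]; exact (hs x hxM).1.congr_of_eventuallyEq e1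
      · rw [(glue_eqOn_M hlam z d).1 hxM]; exact (hs x hxM).2.congr_of_eventuallyEq e2
    · exact absurd hR hx.1
    · have hxR : x ∈ Ioi lam := hR
      obtain ⟨-, -, hs⟩ := solR_spec hlam z (d 4) (d 5)
      have hev : ∀ᶠ y in 𝓝 x, y ∈ Ioi lam := isOpen_Ioi.mem_nhds hxR
      have e1 : glue hlam z d =ᶠ[𝓝 x] solR hlam z (d 4) (d 5) := by
        filter_upwards [hev] with y hy using (glue_eqOn_R hlam z d).1 hy
      have e2 : (fun y ↦ pCoeff lam y * glue' hlam z d y) =ᶠ[𝓝 x]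
          fun y ↦ pCoeff lam y * solR' hlam z (d 4) (d 5) y := by
        filter_upwards [hev] with y hy using by rw [(glue_eqOn_R hlam z d).2 hy]
      refine ⟨?_, ?_⟩
      · rw [(glue_eqOn_R hlam z d).2 hxR]; exact (hs x hxR).1.congr_of_eventuallyEq e1
      · rw [(glue_eqOn_R hlam z d).1 hxR]; exact (hs x hxR).2.congr_of_eventuallyEq e2
  exact ⟨fun x hx ↦ (key x hx).1, fun x hx ↦ (key x hx).2⟩


/-! ### Corollaries of linearity -/

/-- Additivity of `G`, `G′` in the data. [folklore] -/
private theorem glue_add (d₁ d₂ : Fin 6 → ℂ) :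
    glue hlam z (d₁ + d₂) = glue hlam z d₁ + glue hlam z d₂ ∧
      glue' hlam z (d₁ + d₂) = glue' hlam z d₁ + glue' hlam z d₂ := by
  have h := glue_lin hlam z 1 1 d₁ d₂
  simp only [one_smul] at h
  exact h

/-- Homogeneity of `G`, `G′` in the data. [folklore] -/
private theorem glue_smul (c : ℂ) (d : Fin 6 → ℂ) :
    glue hlam z (c • d) = c • glue hlam z d ∧ glue' hlam z (c • d) = c • glue' hlam z d := by
  have h := glue_lin hlam z c 0 d d
  simp only [zero_smul, add_zero] at h
  exact h

/-- `G 0 = 0`, `G′ 0 = 0`. [folklore] -/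
private theorem glue_zero : glue hlam z 0 = 0 ∧ glue' hlam z 0 = 0 := by
  have h := glue_smul hlam z 0 0
  simp only [zero_smul] at h
  exact h

/-! ## §3 The a-priori package of the glued solution (limit circle at the four singular points) -/

include hlam in
/-- Bound for `r = q − z` on a bounded interval `|x| ≤ λ + 2`. [folklore] -/
private theorem norm_q_sub_le {x : ℝ} (hx : |x| ≤ lam + 2) :
    ‖qCoeff lam x - z‖ ≤ (2 * π * lam) ^ 2 * (lam + 2) ^ 2 + ‖z‖ := by
  refine (norm_sub_le _ _).trans (add_le_add_left ?_ _)
  unfold qCoeff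
  rw [Complex.norm_real, Real.norm_eq_abs, abs_of_nonneg (by positivity)]
  have : x ^ 2 ≤ (lam + 2) ^ 2 := by
    rw [← sq_abs x]; exact pow_le_pow_left₀ (abs_nonneg x) hx 2
  exact mul_le_mul_of_nonneg_left this (by positivity)

/-- `r = q − z` is continuous. [folklore] -/
private theorem continuousOn_q_sub (s : Set ℝ) : ContinuousOn (fun x ↦ qCoeff lam x - z) s :=
  ((continuous_qCoeff_def lam).sub continuous_const).continuousOn

include hlam in
/-- (E1) at `λ⁺` for the right piece. [cite: ConnesMoscovici2022, Lemma 1.1 proof "all 4 singular points are LC" (= arXiv Lemma 2.1, chunk p0004:L46–L48)] -/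
private theorem apriori_R (a b : ℂ) :
    (∃ c : ℂ, Tendsto (fun x ↦ pCoeff lam x * solR' hlam z a b x) (𝓝[>] lam) (𝓝 c)) ∧
      Tendsto (fun x ↦ ((x - lam : ℝ) : ℂ) * solR hlam z a b x) (𝓝[>] lam) (𝓝 0) ∧
      IntegrableOn (fun x ↦ ‖solR hlam z a b x‖ ^ 2) (Ioo lam (lam + 2)) := by
  obtain ⟨-, -, hs⟩ := solR_spec hlam z a b
  have hsub : Ioo lam (lam + 2) ⊆ Ioi lam := fun x hx ↦ hx.1
  refine singularEndpoint_right (a := lam) (b := lam + 2) (m := 2 * lam)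
    (Q := (2 * π * lam) ^ 2 * (lam + 2) ^ 2 + ‖z‖) (by linarith) (by linarith)
    (fun x hx ↦ (hs x (hsub hx)).1) (fun x hx ↦ (hs x (hsub hx)).2) (continuousOn_q_sub z _)
    (fun x hx ↦ norm_q_sub_le hlam z (by rw [abs_of_pos (hlam.trans hx.1)]; linarith [hx.2]))
    (fun x hx ↦ ?_)
  unfold pCoeff
  rw [Complex.norm_real, Real.norm_eq_abs, abs_of_neg (by nlinarith [hx.1, hlam]),
    show -(lam ^ 2 - x ^ 2) = (x - lam) * (x + lam) by ring]
  exact mul_comm (2 * lam) (x - lam) ▸ mul_le_mul_of_nonneg_left (by linarith [hx.1]) (by linarith [hx.1])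

include hlam in
/-- (E2) at `λ⁻` for the middle piece. [cite: ConnesMoscovici2022, Lemma 1.1 proof "all 4 singular points are LC" (= arXiv Lemma 2.1, chunk p0004:L46–L48)] -/
private theorem apriori_M_right (a b : ℂ) :
    (∃ c : ℂ, Tendsto (fun x ↦ pCoeff lam x * solM' hlam z a b x) (𝓝[<] lam) (𝓝 c)) ∧
      Tendsto (fun x ↦ ((lam - x : ℝ) : ℂ) * solM hlam z a b x) (𝓝[<] lam) (𝓝 0) ∧
      IntegrableOn (fun x ↦ ‖solM hlam z a b x‖ ^ 2) (Ioo (-lam / 2) lam) := by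
  obtain ⟨-, -, hs⟩ := solM_spec hlam z a b
  have hsub : Ioo (-lam / 2) lam ⊆ Ioo (-lam) lam := fun x hx ↦ ⟨by linarith [hx.1], hx.2⟩
  refine singularEndpoint_left (a := -lam / 2) (b := lam) (m := lam / 2)
    (Q := (2 * π * lam) ^ 2 * (lam + 2) ^ 2 + ‖z‖) (by linarith) (by linarith)
    (fun x hx ↦ (hs x (hsub hx)).1) (fun x hx ↦ (hs x (hsub hx)).2) (continuousOn_q_sub z _)
    (fun x hx ↦ norm_q_sub_le hlam z (abs_le.2 ⟨by linarith [hx.1], by linarith [hx.2]⟩))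
    (fun x hx ↦ ?_)
  unfold pCoeff
  rw [Complex.norm_real, Real.norm_eq_abs, abs_of_pos (by nlinarith [hx.1, hx.2, hlam]),
    show lam ^ 2 - x ^ 2 = (lam - x) * (lam + x) by ring, mul_comm (lam / 2) (lam - x)]
  exact mul_le_mul_of_nonneg_left (by linarith [hx.1]) (by linarith [hx.2])

include hlam in
/-- (E1) at `(−λ)⁺` for the middle piece. [cite: ConnesMoscovici2022, Lemma 1.1 proof "all 4 singular points are LC" (= arXiv Lemma 2.1, chunk p0004:L46–L48)] -/
private theorem apriori_M_left (a b : ℂ) :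
    (∃ c : ℂ, Tendsto (fun x ↦ pCoeff lam x * solM' hlam z a b x) (𝓝[>] (-lam)) (𝓝 c)) ∧
      Tendsto (fun x ↦ ((x - -lam : ℝ) : ℂ) * solM hlam z a b x) (𝓝[>] (-lam)) (𝓝 0) ∧
      IntegrableOn (fun x ↦ ‖solM hlam z a b x‖ ^ 2) (Ioo (-lam) (lam / 2)) := by
  obtain ⟨-, -, hs⟩ := solM_spec hlam z a b
  have hsub : Ioo (-lam) (lam / 2) ⊆ Ioo (-lam) lam := fun x hx ↦ ⟨hx.1, by linarith [hx.2]⟩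
  refine singularEndpoint_right (a := -lam) (b := lam / 2) (m := lam / 2)
    (Q := (2 * π * lam) ^ 2 * (lam + 2) ^ 2 + ‖z‖) (by linarith) (by linarith)
    (fun x hx ↦ (hs x (hsub hx)).1) (fun x hx ↦ (hs x (hsub hx)).2) (continuousOn_q_sub z _)
    (fun x hx ↦ norm_q_sub_le hlam z (abs_le.2 ⟨by linarith [hx.1], by linarith [hx.2]⟩))
    (fun x hx ↦ ?_)
  unfold pCoeff
  rw [Complex.norm_real, Real.norm_eq_abs, abs_of_pos (by nlinarith [hx.1, hx.2, hlam]),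
    show lam ^ 2 - x ^ 2 = (x - -lam) * (lam - x) by ring, mul_comm (lam / 2) (x - -lam)]
  exact mul_le_mul_of_nonneg_left (by linarith [hx.2]) (by linarith [hx.1])

include hlam in
/-- (E2) at `(−λ)⁻` for the left piece. [cite: ConnesMoscovici2022, Lemma 1.1 proof "all 4 singular points are LC" (= arXiv Lemma 2.1, chunk p0004:L46–L48)] -/
private theorem apriori_L (a b : ℂ) :
    (∃ c : ℂ, Tendsto (fun x ↦ pCoeff lam x * solL' hlam z a b x) (𝓝[<] (-lam)) (𝓝 c)) ∧
      Tendsto (fun x ↦ ((-lam - x : ℝ) : ℂ) * solL hlam z a b x) (𝓝[<] (-lam)) (𝓝 0) ∧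
      IntegrableOn (fun x ↦ ‖solL hlam z a b x‖ ^ 2) (Ioo (-lam - 2) (-lam)) := by
  obtain ⟨-, -, hs⟩ := solL_spec hlam z a b
  have hsub : Ioo (-lam - 2) (-lam) ⊆ Iio (-lam) := fun x hx ↦ hx.2
  refine singularEndpoint_left (a := -lam - 2) (b := -lam) (m := 2 * lam)
    (Q := (2 * π * lam) ^ 2 * (lam + 2) ^ 2 + ‖z‖) (by linarith) (by linarith)
    (fun x hx ↦ (hs x (hsub hx)).1) (fun x hx ↦ (hs x (hsub hx)).2) (continuousOn_q_sub z _)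
    (fun x hx ↦ norm_q_sub_le hlam z (by rw [abs_of_neg (by linarith [hx.2])]; linarith [hx.1]))
    (fun x hx ↦ ?_)
  unfold pCoeff
  rw [Complex.norm_real, Real.norm_eq_abs, abs_of_neg (by nlinarith [hx.2, hlam]),
    show -(lam ^ 2 - x ^ 2) = (-lam - x) * (lam - x) by ring, mul_comm (2 * lam) (-lam - x)]
  exact mul_le_mul_of_nonneg_left (by linarith [hx.2]) (by linarith [hx.2])

/-! ### The four boundary values of `p · G′` and their linearity -/

/-- `lim_{x → λ⁺} p (G′ d)`. [folklore] -/
private def bR (d : Fin 6 → ℂ) : ℂ := limUnder (𝓝[>] lam) fun x ↦ pCoeff lam x * glue' hlam z d x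
/-- `lim_{x → λ⁻} p (G′ d)`. [folklore] -/
private def bMr (d : Fin 6 → ℂ) : ℂ := limUnder (𝓝[<] lam) fun x ↦ pCoeff lam x * glue' hlam z d x
/-- `lim_{x → (−λ)⁺} p (G′ d)`. [folklore] -/
private def bMl (d : Fin 6 → ℂ) : ℂ := limUnder (𝓝[>] (-lam)) fun x ↦ pCoeff lam x * glue' hlam z d x
/-- `lim_{x → (−λ)⁻} p (G′ d)`. [folklore] -/
private def bL (d : Fin 6 → ℂ) : ℂ := limUnder (𝓝[<] (-lam)) fun x ↦ pCoeff lam x * glue' hlam z d x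

include hlam in
/-- `p (G d)′ → bR d` at `λ⁺`. [folklore] -/
private theorem tendsto_bR (d : Fin 6 → ℂ) :
    Tendsto (fun x ↦ pCoeff lam x * glue' hlam z d x) (𝓝[>] lam) (𝓝 (bR hlam z d)) := by
  refine tendsto_nhds_limUnder ?_
  obtain ⟨⟨c, hc⟩, -, -⟩ := apriori_R hlam z (d 4) (d 5)
  refine ⟨c, hc.congr' ?_⟩
  filter_upwards [self_mem_nhdsWithin] with x hx
  rw [(glue_eqOn_R hlam z d).2 hx]

include hlam in
/-- `p (G d)′ → bMr d` at `λ⁻`. [folklore] -/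
private theorem tendsto_bMr (d : Fin 6 → ℂ) :
    Tendsto (fun x ↦ pCoeff lam x * glue' hlam z d x) (𝓝[<] lam) (𝓝 (bMr hlam z d)) := by
  refine tendsto_nhds_limUnder ?_
  obtain ⟨⟨c, hc⟩, -, -⟩ := apriori_M_right hlam z (d 2) (d 3)
  refine ⟨c, hc.congr' ?_⟩
  filter_upwards [Ioo_mem_nhdsLT (show -lam < lam by linarith)] with x hx
  rw [(glue_eqOn_M hlam z d).2 hx]

include hlam in
/-- `p (G d)′ → bMl d` at `(−λ)⁺`. [folklore] -/
private theorem tendsto_bMl (d : Fin 6 → ℂ) :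
    Tendsto (fun x ↦ pCoeff lam x * glue' hlam z d x) (𝓝[>] (-lam)) (𝓝 (bMl hlam z d)) := by
  refine tendsto_nhds_limUnder ?_
  obtain ⟨⟨c, hc⟩, -, -⟩ := apriori_M_left hlam z (d 2) (d 3)
  refine ⟨c, hc.congr' ?_⟩
  filter_upwards [Ioo_mem_nhdsGT (show -lam < lam by linarith)] with x hx
  rw [(glue_eqOn_M hlam z d).2 hx]

include hlam in
/-- `p (G d)′ → bL d` at `(−λ)⁻`. [folklore] -/
private theorem tendsto_bL (d : Fin 6 → ℂ) :
    Tendsto (fun x ↦ pCoeff lam x * glue' hlam z d x) (𝓝[<] (-lam)) (𝓝 (bL hlam z d)) := by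
  refine tendsto_nhds_limUnder ?_
  obtain ⟨⟨c, hc⟩, -, -⟩ := apriori_L hlam z (d 0) (d 1)
  refine ⟨c, hc.congr' ?_⟩
  filter_upwards [self_mem_nhdsWithin] with x hx
  rw [(glue_eqOn_L hlam z d).2 hx]

/-- Linearity of a limit functional `d ↦ lim_l p · G′ d`. [folklore] -/
private theorem lim_linear {l : Filter ℝ} [l.NeBot] {B : (Fin 6 → ℂ) → ℂ}
    (hB : ∀ d, Tendsto (fun x ↦ pCoeff lam x * glue' hlam z d x) l (𝓝 (B d))) :
    (∀ d₁ d₂, B (d₁ + d₂) = B d₁ + B d₂) ∧ ∀ (c : ℂ) d, B (c • d) = c • B d := by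
  constructor
  · intro d₁ d₂
    have h := (hB d₁).add (hB d₂)
    refine tendsto_nhds_unique (hB (d₁ + d₂)) (h.congr fun x ↦ ?_)
    rw [(glue_add hlam z d₁ d₂).2, Pi.add_apply]; ring
  · intro c d
    have h := (hB d).const_mul c
    refine tendsto_nhds_unique (hB (c • d)) (h.congr fun x ↦ ?_)
    rw [(glue_smul hlam z c d).2, Pi.smul_apply, smul_eq_mul]; ring

/-- The two matching functionals `d ↦ (jump of p G′ at λ, jump at −λ)` as a linear map to `ℂ²`.
[cite: ConnesMoscovici2022, Lemma 1.1 proof "the logarithmic singularities … have to match. This reduces the number of parameters to 4" (= arXiv Lemma 2.1, chunk p0004:L44–L46)] -/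
private def jumpMap : (Fin 6 → ℂ) →ₗ[ℂ] ℂ × ℂ where
  toFun d := (bMr hlam z d - bR hlam z d, bL hlam z d - bMl hlam z d)
  map_add' d₁ d₂ := by
    have h1 := (lim_linear hlam z (tendsto_bR hlam z)).1 d₁ d₂
    have h2 := (lim_linear hlam z (tendsto_bMr hlam z)).1 d₁ d₂
    have h3 := (lim_linear hlam z (tendsto_bMl hlam z)).1 d₁ d₂
    have h4 := (lim_linear hlam z (tendsto_bL hlam z)).1 d₁ d₂
    ext <;> simp only [Prod.fst_add, Prod.snd_add, h1, h2, h3, h4] <;> ring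
  map_smul' c d := by
    have h1 := (lim_linear hlam z (tendsto_bR hlam z)).2 c d
    have h2 := (lim_linear hlam z (tendsto_bMr hlam z)).2 c d
    have h3 := (lim_linear hlam z (tendsto_bMl hlam z)).2 c d
    have h4 := (lim_linear hlam z (tendsto_bL hlam z)).2 c d
    ext <;> simp only [Prod.smul_fst, Prod.smul_snd, RingHom.id_apply, h1, h2, h3, h4, smul_eq_mul] <;> ring

/-- Unfolding `jumpMap`. [folklore] -/
private theorem jumpMap_apply (d : Fin 6 → ℂ) :
    jumpMap hlam z d = (bMr hlam z d - bR hlam z d, bL hlam z d - bMl hlam z d) := rfl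

/-! ### Square integrability and measurability of the glued solution -/

include hlam in
/-- `‖G d‖²` is integrable on `(λ, ∞)` ((E1) near `λ`, (E3) at `+∞`). [folklore] -/
private theorem integrableOn_sq_R (d : Fin 6 → ℂ) :
    IntegrableOn (fun x ↦ ‖glue hlam z d x‖ ^ 2) (Ioi lam) := by
  obtain ⟨-, -, hs⟩ := solR_spec hlam z (d 4) (d 5)
  have h1 := (apriori_R hlam z (d 4) (d 5)).2.2
  have h2 := prolate_sq_integrableOn_Ioi hlam z (fun x hx ↦ (hs x hx).1) (fun x hx ↦ (hs x hx).2)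
    (x₁ := lam + 1) (by linarith)
  have h : IntegrableOn (fun x ↦ ‖solR hlam z (d 4) (d 5) x‖ ^ 2) (Ioi lam) := by
    have : Ioi lam = Ioo lam (lam + 2) ∪ Ioi (lam + 1) := by
      ext x; simp only [mem_Ioi, mem_union, mem_Ioo]
      constructor
      · intro hx; by_cases h' : x < lam + 2
        · exact Or.inl ⟨hx, h'⟩
        · exact Or.inr (by linarith)
      · rintro (⟨h1, -⟩ | h1) <;> linarith
    rw [this]; exact h1.union h2
  refine h.congr_fun (fun x hx ↦ ?_) measurableSet_Ioi
  rw [(glue_eqOn_R hlam z d).1 hx]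

include hlam in
/-- `‖G d‖²` is integrable on `(−λ, λ)` ((E1) near `−λ`, (E2) near `λ`). [folklore] -/
private theorem integrableOn_sq_M (d : Fin 6 → ℂ) :
    IntegrableOn (fun x ↦ ‖glue hlam z d x‖ ^ 2) (Ioo (-lam) lam) := by
  have h1 := (apriori_M_left hlam z (d 2) (d 3)).2.2
  have h2 := (apriori_M_right hlam z (d 2) (d 3)).2.2
  have h : IntegrableOn (fun x ↦ ‖solM hlam z (d 2) (d 3) x‖ ^ 2) (Ioo (-lam) lam) := by
    have : Ioo (-lam) lam = Ioo (-lam) (lam / 2) ∪ Ioo (-lam / 2) lam := by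
      ext x; simp only [mem_union, mem_Ioo]
      constructor
      · rintro ⟨h1, h2⟩; by_cases h' : x < lam / 2
        · exact Or.inl ⟨h1, h'⟩
        · exact Or.inr ⟨by linarith, h2⟩
      · rintro (⟨h1, h2⟩ | ⟨h1, h2⟩) <;> constructor <;> linarith
    rw [this]; exact h1.union h2
  refine h.congr_fun (fun x hx ↦ ?_) measurableSet_Ioo
  rw [(glue_eqOn_M hlam z d).1 hx]


include hlam in
/-- `‖G d‖²` is integrable on `(−∞, −λ)` ((E2) near `−λ`, (E6) at `−∞`). [folklore] -/
private theorem integrableOn_sq_L (d : Fin 6 → ℂ) :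
    IntegrableOn (fun x ↦ ‖glue hlam z d x‖ ^ 2) (Iio (-lam)) := by
  obtain ⟨-, -, hs⟩ := solL_spec hlam z (d 0) (d 1)
  have h1 := (apriori_L hlam z (d 0) (d 1)).2.2
  have h2 := prolate_sq_integrableOn_Iio hlam z (fun x hx ↦ (hs x hx).1) (fun x hx ↦ (hs x hx).2)
    (x₁ := -lam - 1) (by linarith)
  have h : IntegrableOn (fun x ↦ ‖solL hlam z (d 0) (d 1) x‖ ^ 2) (Iio (-lam)) := by
    have : Iio (-lam) = Ioo (-lam - 2) (-lam) ∪ Iio (-lam - 1) := by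
      ext x; simp only [mem_Iio, mem_union, mem_Ioo]
      constructor
      · intro hx; by_cases h' : -lam - 2 < x
        · exact Or.inl ⟨h', hx⟩
        · exact Or.inr (by linarith)
      · rintro (⟨-, h1⟩ | h1) <;> linarith
    rw [this]; exact h1.union h2
  refine h.congr_fun (fun x hx ↦ ?_) measurableSet_Iio
  rw [(glue_eqOn_L hlam z d).1 hx]

include hlam in
/-- `G d` is a.e. strongly measurable (continuous on each open piece). [folklore] -/
private theorem aestronglyMeasurable_glue (d : Fin 6 → ℂ) : AEStronglyMeasurable (glue hlam z d) volume := by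
  obtain ⟨-, -, hsL⟩ := solL_spec hlam z (d 0) (d 1)
  obtain ⟨-, -, hsM⟩ := solM_spec hlam z (d 2) (d 3)
  obtain ⟨-, -, hsR⟩ := solR_spec hlam z (d 4) (d 5)
  have hcL : ContinuousOn (solL hlam z (d 0) (d 1)) (Iio (-lam)) :=
    fun x hx ↦ (hsL x hx).1.continuousAt.continuousWithinAt
  have hcM : ContinuousOn (solM hlam z (d 2) (d 3)) (Ioo (-lam) lam) :=
    fun x hx ↦ (hsM x hx).1.continuousAt.continuousWithinAt
  have hcR : ContinuousOn (solR hlam z (d 4) (d 5)) (Ioi lam) :=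
    fun x hx ↦ (hsR x hx).1.continuousAt.continuousWithinAt
  unfold glue
  exact (((aestronglyMeasurable_indicator_iff measurableSet_Iio).2
      (hcL.aestronglyMeasurable measurableSet_Iio)).add
    ((aestronglyMeasurable_indicator_iff measurableSet_Ioo).2
      (hcM.aestronglyMeasurable measurableSet_Ioo))).add
    ((aestronglyMeasurable_indicator_iff measurableSet_Ioi).2
      (hcR.aestronglyMeasurable measurableSet_Ioi))

include hlam in
/-- **`G d ∈ L²(ℝ)`** ("all 4 singular points are LC"). [cite: ConnesMoscovici2022, Lemma 1.1 proof (= arXiv Lemma 2.1, chunk p0004:L46–L48)] -/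
private theorem memLp_glue (d : Fin 6 → ℂ) : MemLp (glue hlam z d) 2 volume := by
  rw [memLp_two_iff_integrable_sq_norm (aestronglyMeasurable_glue hlam z d)]
  have h0 : IntegrableOn (fun x ↦ ‖glue hlam z d x‖ ^ 2) ({-lam, lam} : Set ℝ) := by
    have hz : volume ({-lam, lam} : Set ℝ) = 0 := (Set.toFinite _).measure_zero volume
    rw [IntegrableOn, Measure.restrict_eq_zero.2 hz]
    exact integrable_zero_measure
  have h := (((integrableOn_sq_L hlam z d).union (integrableOn_sq_M hlam z d)).union
    (integrableOn_sq_R hlam z d)).union h0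
  rw [← integrableOn_univ]
  refine h.mono_set fun x _ ↦ ?_
  simp only [mem_union, mem_Iio, mem_Ioo, mem_Ioi, mem_insert_iff, mem_singleton_iff]
  rcases lt_trichotomy x (-lam) with h1 | h1 | h1
  · exact Or.inl (Or.inl (Or.inl h1))
  · exact Or.inr (Or.inl h1)
  rcases lt_trichotomy x lam with h2 | h2 | h2
  · exact Or.inl (Or.inl (Or.inr ⟨h1, h2⟩))
  · exact Or.inr (Or.inr h2)
  · exact Or.inl (Or.inr h2)

include hlam in
/-- **Decay package at `±∞`**: `G d`, `(G d)′` are bounded outside `|x| ≥ max(2λ, 1) + 1` (parts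
(E3)/(E6) of the endpoint file). [cite: ConnesMoscovici2022, Lemma 1.1 proof (= arXiv Lemma 2.1, chunk p0004:L46–L48)] -/
private theorem glue_bounded_far (d : Fin 6 → ℂ) :
    ∃ C R : ℝ, ∀ x, R ≤ |x| → ‖glue hlam z d x‖ ≤ C ∧ ‖glue' hlam z d x‖ ≤ C := by
  obtain ⟨-, -, hsL⟩ := solL_spec hlam z (d 0) (d 1)
  obtain ⟨-, -, hsR⟩ := solR_spec hlam z (d 4) (d 5)
  obtain ⟨C₁, hC₁⟩ := prolate_decay_atTop hlam z (fun x hx ↦ (hsR x hx).1) (fun x hx ↦ (hsR x hx).2)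
  obtain ⟨C₂, hC₂⟩ := prolate_decay_atBot hlam z (fun x hx ↦ (hsL x hx).1) (fun x hx ↦ (hsL x hx).2)
  set M : ℝ := max (2 * lam) 1 with hM
  have hM1 : 1 ≤ M := le_max_right _ _
  have hMl : lam < M := by rw [hM]; linarith [le_max_left (2 * lam) 1]
  refine ⟨max C₁ C₂, M + 1, fun x hx ↦ ?_⟩
  rcases le_or_gt 0 x with h0 | h0
  · rw [abs_of_nonneg h0] at hx
    have hxM : M < x := by linarith
    have hxR : x ∈ Ioi lam := lt_trans hMl hxM
    obtain ⟨h1, h2⟩ := hC₁ x hxM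
    have hx1 : 1 ≤ x := by linarith
    have hC0 : 0 ≤ C₁ := by
      have := (norm_nonneg _).trans h1
      exact (div_nonneg_iff.1 this).elim (fun h ↦ h.1) fun h ↦ absurd h.2 (by linarith)
    have hdiv : C₁ / x ≤ max C₁ C₂ := (div_le_self hC0 hx1).trans (le_max_left _ _)
    rw [(glue_eqOn_R hlam z d).1 hxR, (glue_eqOn_R hlam z d).2 hxR]
    exact ⟨h1.trans hdiv, h2.trans hdiv⟩
  · rw [abs_of_neg h0] at hx
    have hxM : x < -M := by linarith
    have hxL : x ∈ Iio (-lam) := by simp only [mem_Iio]; linarith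
    obtain ⟨h1, h2⟩ := hC₂ x hxM
    have hx1 : 1 ≤ -x := by linarith
    have hC0 : 0 ≤ C₂ := by
      have := (norm_nonneg _).trans h1
      exact (div_nonneg_iff.1 this).elim (fun h ↦ h.1) fun h ↦ absurd h.2 (by linarith)
    have hdiv : C₂ / (-x) ≤ max C₁ C₂ := (div_le_self hC0 hx1).trans (le_max_right _ _)
    rw [(glue_eqOn_L hlam z d).1 hxL, (glue_eqOn_L hlam z d).2 hxL]
    exact ⟨h1.trans hdiv, h2.trans hdiv⟩

include hlam in
/-- **Green's identity for the glued solution**: `∫ G d · (Wθ − zθ) = θ(λ)·J₁(d) + θ(−λ)·J₂(d)`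
with `(J₁, J₂) = jumpMap d`. [cite: ConnesMoscovici2022, Lemma 1.1 proof (= arXiv Lemma 2.1, chunk p0004:L44–L48)] -/
private theorem integral_glue_mul_eq_jumps (d : Fin 6 → ℂ) (θ : 𝓢(ℝ, ℂ)) :
    ∫ x, glue hlam z d x * (prolateWaveOpFun lam θ x - z * θ x) =
      θ lam * (jumpMap hlam z d).1 + θ (-lam) * (jumpMap hlam z d).2 := by
  obtain ⟨C, R, hb⟩ := glue_bounded_far hlam z d
  have hll : -lam < lam := by linarith
  -- `(x ∓ λ) G → 0` at the four one-sided filters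
  have h0lp : Tendsto (fun x ↦ ((x - lam : ℝ) : ℂ) * glue hlam z d x) (𝓝[>] lam) (𝓝 0) :=
    (apriori_R hlam z (d 4) (d 5)).2.1.congr' (by
      filter_upwards [self_mem_nhdsWithin] with x hx; rw [(glue_eqOn_R hlam z d).1 hx])
  have h0lm : Tendsto (fun x ↦ ((x - lam : ℝ) : ℂ) * glue hlam z d x) (𝓝[<] lam) (𝓝 0) := by
    have h := ((apriori_M_right hlam z (d 2) (d 3)).2.1).neg
    rw [neg_zero] at h
    refine h.congr' ?_
    filter_upwards [Ioo_mem_nhdsLT hll] with x hx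
    rw [(glue_eqOn_M hlam z d).1 hx]; push_cast; ring
  have h0mp : Tendsto (fun x ↦ ((x - -lam : ℝ) : ℂ) * glue hlam z d x) (𝓝[>] (-lam)) (𝓝 0) :=
    (apriori_M_left hlam z (d 2) (d 3)).2.1.congr' (by
      filter_upwards [Ioo_mem_nhdsGT hll] with x hx; rw [(glue_eqOn_M hlam z d).1 hx])
  have h0mm : Tendsto (fun x ↦ ((x - -lam : ℝ) : ℂ) * glue hlam z d x) (𝓝[<] (-lam)) (𝓝 0) := by
    have h := ((apriori_L hlam z (d 0) (d 1)).2.1).neg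
    rw [neg_zero] at h
    refine h.congr' ?_
    filter_upwards [self_mem_nhdsWithin] with x hx
    rw [(glue_eqOn_L hlam z d).1 hx]; push_cast; ring
  have h := integral_mul_prolateWave_sub_eq_jumps hlam θ (glue_sol hlam z d).1 (glue_sol hlam z d).2
    (memLp_glue hlam z d) hb (tendsto_bMr hlam z d) (tendsto_bR hlam z d) (tendsto_bL hlam z d)
    (tendsto_bMl hlam z d) h0lm h0lp h0mm h0mp
  rw [h, jumpMap_apply]

/-! ## §4 The linear map `d ↦ [G d] ∈ L²(ℝ)` and the count -/

/-- `T d = [G d] ∈ L²(ℝ)`. [folklore] -/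
private def toL2 : (Fin 6 → ℂ) →ₗ[ℂ] L2R where
  toFun d := (memLp_glue hlam z d).toLp (glue hlam z d)
  map_add' d₁ d₂ := by
    rw [← MemLp.toLp_add]
    exact (MemLp.toLp_eq_toLp_iff _ _).2 (Eventually.of_forall fun x ↦ by
      rw [(glue_add hlam z d₁ d₂).1])
  map_smul' c d := by
    rw [RingHom.id_apply, ← MemLp.toLp_const_smul]
    exact (MemLp.toLp_eq_toLp_iff _ _).2 (Eventually.of_forall fun x ↦ by
      rw [(glue_smul hlam z c d).1])

/-- The `L²` class of `G d` is represented by `G d`. [folklore] -/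
private theorem coeFn_toL2 (d : Fin 6 → ℂ) :
    ((toL2 hlam z d : L2R) : ℝ → ℂ) =ᵐ[volume] glue hlam z d :=
  MemLp.coeFn_toLp (memLp_glue hlam z d)

/-- A solution pair that vanishes a.e. on an open interval of its component has zero data there. [folklore] -/
private theorem data_eq_zero_of_ae {V : Set ℝ} (hV : IsOpen V) {g g' : ℝ → ℂ}
    (hg : ∀ x ∈ V, HasDerivAt g (g' x) x) (hae : ∀ᵐ x, x ∈ V → g x = 0) {x₀ : ℝ} (hx₀ : x₀ ∈ V) :
    g x₀ = 0 ∧ g' x₀ = 0 := by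
  have heq : EqOn g (fun _ ↦ (0 : ℂ)) V := by
    refine Measure.eqOn_open_of_ae_eq (μ := volume) ?_ hV
      (fun x hx ↦ (hg x hx).continuousAt.continuousWithinAt) continuousOn_const
    rw [EventuallyEq, ae_restrict_iff' hV.measurableSet]
    exact hae
  refine ⟨heq hx₀, ?_⟩
  have h1 : HasDerivAt g 0 x₀ :=
    (hasDerivAt_const x₀ (0 : ℂ)).congr_of_eventuallyEq (heq.eventuallyEq_of_mem (hV.mem_nhds hx₀))
  exact (hg x₀ hx₀).unique h1

include hlam in
/-- **`T` is injective** (a continuous representative vanishing a.e. vanishes, so all six data are `0`).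
[cite: ConnesMoscovici2022, Lemma 1.1 proof "uniquely specified by six parameters" (= arXiv Lemma 2.1, chunk p0004:L41–L44)] -/
private theorem toL2_injective : Function.Injective (toL2 hlam z) := by
  rw [← LinearMap.ker_eq_bot, LinearMap.ker_eq_bot']
  intro d hd
  have hae : glue hlam z d =ᵐ[volume] (0 : ℝ → ℂ) := by
    have h1 := coeFn_toL2 hlam z d
    rw [hd] at h1
    exact h1.symm.trans (Lp.coeFn_zero _ _ _)
  obtain ⟨hL0, hL1, hsL⟩ := solL_spec hlam z (d 0) (d 1)
  obtain ⟨hM0, hM1, hsM⟩ := solM_spec hlam z (d 2) (d 3)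
  obtain ⟨hR0, hR1, hsR⟩ := solR_spec hlam z (d 4) (d 5)
  have haeL : ∀ᵐ x, x ∈ Iio (-lam) → solL hlam z (d 0) (d 1) x = 0 := by
    filter_upwards [hae] with x hx hxV; rw [← (glue_eqOn_L hlam z d).1 hxV, hx, Pi.zero_apply]
  have haeM : ∀ᵐ x, x ∈ Ioo (-lam) lam → solM hlam z (d 2) (d 3) x = 0 := by
    filter_upwards [hae] with x hx hxV; rw [← (glue_eqOn_M hlam z d).1 hxV, hx, Pi.zero_apply]
  have haeR : ∀ᵐ x, x ∈ Ioi lam → solR hlam z (d 4) (d 5) x = 0 := by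
    filter_upwards [hae] with x hx hxV; rw [← (glue_eqOn_R hlam z d).1 hxV, hx, Pi.zero_apply]
  obtain ⟨eL0, eL1⟩ := data_eq_zero_of_ae isOpen_Iio (fun x hx ↦ (hsL x hx).1) haeL
    (x₀ := -lam - 1) (by simp only [mem_Iio]; linarith)
  obtain ⟨eM0, eM1⟩ := data_eq_zero_of_ae isOpen_Ioo (fun x hx ↦ (hsM x hx).1) haeM
    (zero_mem_Ioo hlam)
  obtain ⟨eR0, eR1⟩ := data_eq_zero_of_ae isOpen_Ioi (fun x hx ↦ (hsR x hx).1) haeR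
    (x₀ := lam + 1) (by simp only [mem_Ioi]; linarith)
  ext i
  fin_cases i
  · simpa using (hL0.symm.trans eL0)
  · simpa [eL1] using hL1.symm
  · simpa using (hM0.symm.trans eM0)
  · simpa [eM1] using hM1.symm
  · simpa using (hR0.symm.trans eR0)
  · simpa [eR1] using hR1.symm

include hlam in
/-- **Matching data give eigenvectors** ("Conversely, since all 4 singular points are LC, any solution
of `Wξ = zξ` belongs to `Dom(W_max)`"): if both jumps vanish, `[G d] ∈ Ker(W_max − z)`.
[cite: ConnesMoscovici2022, Lemma 1.1 proof (= arXiv Lemma 2.1, chunk p0004:L46–L48)] -/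
private theorem toL2_mem_eigenspace {d : Fin 6 → ℂ} (hd : d ∈ LinearMap.ker (jumpMap hlam z)) :
    toL2 hlam z d ∈ (prolateMax lam).eigenspace z := by
  rw [LinearMap.mem_ker] at hd
  refine mem_eigenspace_of_integral_eq_zero _ fun θ ↦ ?_
  have h := integral_glue_mul_eq_jumps hlam z d θ
  rw [hd, Prod.fst_zero, Prod.snd_zero, mul_zero, mul_zero, add_zero] at h
  rw [← h]
  exact integral_congr_ae (by filter_upwards [coeFn_toL2 hlam z d] with x hx; rw [hx])

/-- A Schwartz function equal to `1` at `a` and to `0` at `b ≠ a` (a smooth bump). [folklore] -/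
private theorem exists_schwartz_one_zero {a b : ℝ} (hab : a ≠ b) :
    ∃ θ : 𝓢(ℝ, ℂ), θ a = 1 ∧ θ b = 0 := by
  have hd : 0 < dist b a := dist_pos.2 hab.symm
  let φ : ContDiffBump a := ⟨dist b a / 2, dist b a, by linarith, by linarith⟩
  have hφs : ContDiff ℝ ∞ (fun x ↦ (φ x : ℂ)) := Complex.ofRealCLM.contDiff.comp φ.contDiff
  have hφc : HasCompactSupport (fun x ↦ (φ x : ℂ)) := φ.hasCompactSupport.comp_left Complex.ofReal_zero
  refine ⟨hφc.toSchwartzMap hφs, ?_, ?_⟩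
  · change ((φ a : ℝ) : ℂ) = 1
    rw [φ.one_of_mem_closedBall (Metric.mem_closedBall_self (by positivity))]; simp
  · change ((φ b : ℝ) : ℂ) = 0
    rw [φ.zero_of_le_dist (le_rfl)]; simp

include hlam in
/-- **Eigenvectors have matching data** ("the fact that `Wξ ∈ L²(ℝ)` impl[ies] that the logarithmic
singularities … have to match"): every `ξ ∈ Ker(W_max − z)` is `[G d]` for some `d` with
`jumpMap d = 0`. [cite: ConnesMoscovici2022, Lemma 1.1 proof (= arXiv Lemma 2.1, chunk p0004:L41–L46)] -/
private theorem eigenspace_le_map :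
    (prolateMax lam).eigenspace z ≤ (LinearMap.ker (jumpMap hlam z)).map (toL2 hlam z) := by
  intro ξ hξ
  obtain ⟨hdom, hW⟩ := LinearPMap.mem_eigenspace_iff.1 hξ
  set ξd : (prolateMax lam).domain := ⟨ξ, hdom⟩ with hξd
  have hW' : prolateMax lam ξd = z • (ξd : L2R) := hW
  obtain ⟨gL, gL', hgL, huL, haeL⟩ := exists_sol_Iio_ae_eq_of_eigen hlam ξd hW'
  obtain ⟨gM, gM', hgM, huM, haeM⟩ := exists_sol_Ioo_ae_eq_of_eigen hlam ξd hW'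
  obtain ⟨gR, gR', hgR, huR, haeR⟩ := exists_sol_Ioi_ae_eq_of_eigen hlam ξd hW'
  set d : Fin 6 → ℂ := ![gL (-lam - 1), pCoeff lam (-lam - 1) * gL' (-lam - 1), gM 0,
    pCoeff lam 0 * gM' 0, gR (lam + 1), pCoeff lam (lam + 1) * gR' (lam + 1)] with hd_def
  -- the chosen solutions with these data ARE the representatives
  obtain ⟨hL0, hL1, hsL⟩ := solL_spec hlam z (d 0) (d 1)
  obtain ⟨hM0, hM1, hsM⟩ := solM_spec hlam z (d 2) (d 3)
  obtain ⟨hR0, hR1, hsR⟩ := solR_spec hlam z (d 4) (d 5)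
  have eL : EqOn (solL hlam z (d 0) (d 1)) gL (Iio (-lam)) :=
    (eqOn_of_sol_Iio hlam (neg_sub_one_lt (lam := lam)) (fun x hx ↦ (hsL x hx).1)
      (fun x hx ↦ (hsL x hx).2) hgL huL (by rw [hL0]; rfl) (by rw [hL1]; rfl)).1
  have eM : EqOn (solM hlam z (d 2) (d 3)) gM (Ioo (-lam) lam) :=
    (eqOn_of_sol_Ioo (Ioo_subset_setOf_ne_ne lam) (zero_mem_Ioo hlam) (fun x hx ↦ (hsM x hx).1)
      (fun x hx ↦ (hsM x hx).2) hgM huM (by rw [hM0]; rfl) (by rw [hM1]; rfl)).1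
  have eR : EqOn (solR hlam z (d 4) (d 5)) gR (Ioi lam) :=
    (eqOn_of_sol_Ioi hlam (lt_add_one' (lam := lam)) (fun x hx ↦ (hsR x hx).1)
      (fun x hx ↦ (hsR x hx).2) hgR huR (by rw [hR0]; rfl) (by rw [hR1]; rfl)).1
  -- `ξ = G d` a.e.
  have hae : (ξ : ℝ → ℂ) =ᵐ[volume] glue hlam z d := by
    have hnull : ∀ᵐ x : ℝ, x ∉ ({-lam, lam} : Set ℝ) :=
      compl_mem_ae_iff.2 ((Set.toFinite _).measure_zero volume)
    filter_upwards [haeL, haeM, haeR, hnull] with x h1 h2 h3 h4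
    simp only [mem_insert_iff, mem_singleton_iff, not_or] at h4
    rcases lt_trichotomy x (-lam) with h | h | h
    · rw [(glue_eqOn_L hlam z d).1 h, eL h]; exact h1 h
    · exact absurd h h4.1
    rcases lt_trichotomy x lam with h' | h' | h'
    · have hm : x ∈ Ioo (-lam) lam := ⟨h, h'⟩
      rw [(glue_eqOn_M hlam z d).1 hm, eM hm]; exact h2 hm
    · exact absurd h' h4.2
    · have hr : x ∈ Ioi lam := h'
      rw [(glue_eqOn_R hlam z d).1 hr, eR hr]; exact h3 hr
  have hT : toL2 hlam z d = ξ := by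
    apply Lp.ext
    exact (coeFn_toL2 hlam z d).trans hae.symm
  -- the jumps vanish: `θ(λ) J₁ + θ(−λ) J₂ = ∫ ξ (Wθ − zθ) = 0` for every Schwartz `θ`
  have hJ : ∀ θ : 𝓢(ℝ, ℂ), θ lam * (jumpMap hlam z d).1 + θ (-lam) * (jumpMap hlam z d).2 = 0 := by
    intro θ
    rw [← integral_glue_mul_eq_jumps hlam z d θ,
      ← integral_mul_prolateWave_sub_eq_zero_of_eigen ξd hW' θ]
    exact integral_congr_ae (by filter_upwards [hae] with x hx; rw [← hx])
  have hll : lam ≠ -lam := by linarith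
  obtain ⟨θ₁, h1a, h1b⟩ := exists_schwartz_one_zero hll
  obtain ⟨θ₂, h2a, h2b⟩ := exists_schwartz_one_zero hll.symm
  have hJ1 := hJ θ₁
  rw [h1a, h1b, one_mul, zero_mul, add_zero] at hJ1
  have hJ2 := hJ θ₂
  rw [h2a, h2b, one_mul, zero_mul, zero_add] at hJ2
  refine ⟨d, ?_, hT⟩
  simp only [SetLike.mem_coe, LinearMap.mem_ker, Prod.ext_iff, Prod.fst_zero, Prod.snd_zero]
  exact ⟨hJ1, hJ2⟩

include hlam in
/-- A data vector supported on the outer right piece: its left and middle solutions vanish. [folklore] -/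
private theorem solM_zero_zero : EqOn (solM hlam z 0 0) 0 (Ioo (-lam) lam) ∧
    EqOn (solM' hlam z 0 0) 0 (Ioo (-lam) lam) := by
  have h := solM_lin hlam z 0 0 0 0 0 0
  simp only [mul_zero, add_zero, zero_mul] at h
  exact ⟨fun x hx ↦ by rw [h.1 hx]; rfl, fun x hx ↦ by rw [h.2 hx]; rfl⟩

include hlam in
/-- The left chosen solution with zero data vanishes. [folklore] -/
private theorem solL_zero_zero : EqOn (solL hlam z 0 0) 0 (Iio (-lam)) ∧
    EqOn (solL' hlam z 0 0) 0 (Iio (-lam)) := by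
  have h := solL_lin hlam z 0 0 0 0 0 0
  simp only [mul_zero, add_zero, zero_mul] at h
  exact ⟨fun x hx ↦ by rw [h.1 hx]; rfl, fun x hx ↦ by rw [h.2 hx]; rfl⟩

include hlam in
/-- The right chosen solution with zero data vanishes. [folklore] -/
private theorem solR_zero_zero : EqOn (solR hlam z 0 0) 0 (Ioi lam) ∧
    EqOn (solR' hlam z 0 0) 0 (Ioi lam) := by
  have h := solR_lin hlam z 0 0 0 0 0 0
  simp only [mul_zero, add_zero, zero_mul] at h
  exact ⟨fun x hx ↦ by rw [h.1 hx]; rfl, fun x hx ↦ by rw [h.2 hx]; rfl⟩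

include hlam in
/-- **The two matching functionals are independent**: `jumpMap` is onto `ℂ²` (on each outer
component there is a solution whose `p g′` has a non-zero boundary value at `±λ` — t10's
`exists_sol_Ioi/Iio_tendsto_ne_zero`, itself from Abel's identity: if all boundary values vanished,
all Wronskians would vanish). [cite: ConnesMoscovici2022, Lemma 1.1 proof "This reduces the number of parameters to 4" (= arXiv Lemma 2.1, chunk p0004:L44–L46)] -/
private theorem jumpMap_surjective : Function.Surjective (jumpMap hlam z) := by
  have hll : -lam < lam := by linarith
  -- a data vector with jump `(−c, 0)`, `c ≠ 0`
  obtain ⟨g, g', hs, c, hc, hlim⟩ := exists_sol_Ioi_tendsto_ne_zero hlam z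
  set d₁ : Fin 6 → ℂ := ![0, 0, 0, 0, g (lam + 1), pCoeff lam (lam + 1) * g' (lam + 1)] with hd₁
  obtain ⟨hR0, hR1, hsR⟩ := solR_spec hlam z (d₁ 4) (d₁ 5)
  have eR : EqOn (solR' hlam z (d₁ 4) (d₁ 5)) g' (Ioi lam) :=
    (eqOn_of_sol_Ioi hlam (lt_add_one' (lam := lam)) (fun x hx ↦ (hsR x hx).1)
      (fun x hx ↦ (hsR x hx).2) (fun x hx ↦ (hs x hx).1) (fun x hx ↦ (hs x hx).2)
      (by rw [hR0]; rfl) (by rw [hR1]; rfl)).2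
  have hbR : bR hlam z d₁ = c := by
    refine tendsto_nhds_unique (tendsto_bR hlam z d₁) (hlim.congr' ?_)
    filter_upwards [self_mem_nhdsWithin] with x hx
    rw [(glue_eqOn_R hlam z d₁).2 hx, eR hx]
  have hbMr : bMr hlam z d₁ = 0 := by
    refine tendsto_nhds_unique (tendsto_bMr hlam z d₁) (tendsto_const_nhds.congr' ?_)
    filter_upwards [Ioo_mem_nhdsLT hll] with x hx
    rw [(glue_eqOn_M hlam z d₁).2 hx, show d₁ 2 = 0 from rfl, show d₁ 3 = 0 from rfl,
      (solM_zero_zero hlam z).2 hx, Pi.zero_apply, mul_zero]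
  have hbMl : bMl hlam z d₁ = 0 := by
    refine tendsto_nhds_unique (tendsto_bMl hlam z d₁) (tendsto_const_nhds.congr' ?_)
    filter_upwards [Ioo_mem_nhdsGT hll] with x hx
    rw [(glue_eqOn_M hlam z d₁).2 hx, show d₁ 2 = 0 from rfl, show d₁ 3 = 0 from rfl,
      (solM_zero_zero hlam z).2 hx, Pi.zero_apply, mul_zero]
  have hbL : bL hlam z d₁ = 0 := by
    refine tendsto_nhds_unique (tendsto_bL hlam z d₁) (tendsto_const_nhds.congr' ?_)
    filter_upwards [self_mem_nhdsWithin] with x hx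
    rw [(glue_eqOn_L hlam z d₁).2 hx, show d₁ 0 = 0 from rfl, show d₁ 1 = 0 from rfl,
      (solL_zero_zero hlam z).2 hx, Pi.zero_apply, mul_zero]
  have hJ₁ : jumpMap hlam z d₁ = (-c, 0) := by
    rw [jumpMap_apply, hbR, hbMr, hbMl, hbL]; simp
  -- a data vector with jump `(0, c′)`, `c′ ≠ 0`
  obtain ⟨h, h', hsh, c', hc', hlim'⟩ := exists_sol_Iio_tendsto_ne_zero hlam z
  set d₂ : Fin 6 → ℂ := ![h (-lam - 1), pCoeff lam (-lam - 1) * h' (-lam - 1), 0, 0, 0, 0] with hd₂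
  obtain ⟨hL0, hL1, hsL⟩ := solL_spec hlam z (d₂ 0) (d₂ 1)
  have eL : EqOn (solL' hlam z (d₂ 0) (d₂ 1)) h' (Iio (-lam)) :=
    (eqOn_of_sol_Iio hlam (neg_sub_one_lt (lam := lam)) (fun x hx ↦ (hsL x hx).1)
      (fun x hx ↦ (hsL x hx).2) (fun x hx ↦ (hsh x hx).1) (fun x hx ↦ (hsh x hx).2)
      (by rw [hL0]; rfl) (by rw [hL1]; rfl)).2
  have hbL' : bL hlam z d₂ = c' := by
    refine tendsto_nhds_unique (tendsto_bL hlam z d₂) (hlim'.congr' ?_)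
    filter_upwards [self_mem_nhdsWithin] with x hx
    rw [(glue_eqOn_L hlam z d₂).2 hx, eL hx]
  have hbMr' : bMr hlam z d₂ = 0 := by
    refine tendsto_nhds_unique (tendsto_bMr hlam z d₂) (tendsto_const_nhds.congr' ?_)
    filter_upwards [Ioo_mem_nhdsLT hll] with x hx
    rw [(glue_eqOn_M hlam z d₂).2 hx, show d₂ 2 = 0 from rfl, show d₂ 3 = 0 from rfl,
      (solM_zero_zero hlam z).2 hx, Pi.zero_apply, mul_zero]
  have hbMl' : bMl hlam z d₂ = 0 := by
    refine tendsto_nhds_unique (tendsto_bMl hlam z d₂) (tendsto_const_nhds.congr' ?_)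
    filter_upwards [Ioo_mem_nhdsGT hll] with x hx
    rw [(glue_eqOn_M hlam z d₂).2 hx, show d₂ 2 = 0 from rfl, show d₂ 3 = 0 from rfl,
      (solM_zero_zero hlam z).2 hx, Pi.zero_apply, mul_zero]
  have hbR' : bR hlam z d₂ = 0 := by
    refine tendsto_nhds_unique (tendsto_bR hlam z d₂) (tendsto_const_nhds.congr' ?_)
    filter_upwards [self_mem_nhdsWithin] with x hx
    rw [(glue_eqOn_R hlam z d₂).2 hx, show d₂ 4 = 0 from rfl, show d₂ 5 = 0 from rfl,
      (solR_zero_zero hlam z).2 hx, Pi.zero_apply, mul_zero]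
  have hJ₂ : jumpMap hlam z d₂ = (0, c') := by
    rw [jumpMap_apply, hbR', hbMr', hbMl', hbL']; simp
  -- combine
  intro w
  refine ⟨(-(w.1 / c)) • d₁ + (w.2 / c') • d₂, ?_⟩
  rw [map_add, map_smul, map_smul, hJ₁, hJ₂]
  ext <;> simp <;> field_simp

include hlam in
/-- **`dim Ker(W_max − z) = 4` for every `z ∈ ℂ`** — six parameters on the three components, minus
the two matching conditions at `±λ`; every matched solution is square integrable.
[cite: ConnesMoscovici2022, Lemma 1.1 and its proof (= arXiv:2112.05500 Lemma 2.1, chunk p0004:L39–L48)] -/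
theorem finrank_eigenspace_prolateMax (z : ℂ) :
    Module.finrank ℂ ((prolateMax lam).eigenspace z) = 4 := by
  have hK : (prolateMax lam).eigenspace z = (LinearMap.ker (jumpMap hlam z)).map (toL2 hlam z) := by
    refine le_antisymm (eigenspace_le_map hlam z) ?_
    rintro _ ⟨d, hd, rfl⟩
    exact toL2_mem_eigenspace hlam z hd
  rw [hK, ← (Submodule.equivMapOfInjective _ (toL2_injective hlam z)
    (LinearMap.ker (jumpMap hlam z))).finrank_eq]
  have h1 := LinearMap.finrank_range_add_finrank_ker (jumpMap hlam z)
  rw [LinearMap.range_eq_top.2 (jumpMap_surjective hlam z), finrank_top] at h1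
  have h2 : Module.finrank ℂ (ℂ × ℂ) = 2 := by simp
  have h3 : Module.finrank ℂ (Fin 6 → ℂ) = 6 := by simp
  omega

end Chosen

/-- RH-FREE (PROVED). **Lemma 1.1** (= arXiv Lemma 2.1): "The deficiency indices of `W_min` are
`(4,4)`" — `dim Ker(W_max ∓ i) = 4`, both finite-dimensional.  DISCHARGES the named fact
`CM22_lemma_1_1` (net debt −1).
[cite: ConnesMoscovici2022, Lemma 1.1 (= arXiv:2112.05500 Lemma 2.1, chunk p0004:L39; proof L41–L48)] -/
theorem CM22_lemma_1_1_holds : CM22_lemma_1_1 := fun _ hlam ↦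
  ⟨finrank_eigenspace_prolateMax hlam I, finrank_eigenspace_prolateMax hlam (-I),
    Module.finite_of_finrank_eq_succ (finrank_eigenspace_prolateMax hlam I),
    Module.finite_of_finrank_eq_succ (finrank_eigenspace_prolateMax hlam (-I))⟩

end Literature.NumberTheory.ConnesMoscovici2022

end
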